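import Summits.CriticalPhenomena.PercolationContinuityZ3.Theorems.SoloBlindPeriodicFinRate
import HarnessLib

/-!
# The periodic-fin rungs as one monotone family: the set of good periods

Seat `solo-CriticalPhenomena-blind` (generation 2).  For a period `M : ℕ` let
`S_M = {0 ≤ x₀} ∪ {x₁ = 0, x₀ ≤ -2} ∪ {x₁ = 0, x₀ = -1, M ∣ x₂}` — the half-space with a perpendicular
half-plane glued on along the feet `(-1, 0, Mj)` — and let `finPeriods ⊆ ℕ` be the set of periods `M`
for which `θ_{G[S_M]}(p_c(ℤ³)) = 0` at the origin.  This file records, sorry-free, how the rungs proved by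
this seat sit inside one object:

* `zero_mem_finPeriods` — `0 ∈ finPeriods` unconditionally (`M = 0` is a single foot: the sparse-fin
  theorem `theta_induce_sparseFin_criticalProbI_eq_zero` with an empty pair sum);
* `finPeriods_dvd_closed` — `finPeriods` is closed upwards under divisibility (`S_{M'} ⊆ S_M` for `M ∣ M'`,
  `theta_induce_mono_holds`);
* `one_mem_finPeriods_iff` / `finPeriods_eq_univ_iff` — `1 ∈ finPeriods ↔ FinRung ↔ finPeriods = univ`
  (`S_1` is the fully attached fin of `SoloBlindOpenRungs.FinRung`);
* `eventually_mem_finPeriods_of_lineRate` / `finite_compl_finPeriods_of_lineRate` — under `LineRate`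
  all large periods are good, i.e. the complement of `finPeriods` is finite (`periodicFin_of_lineRate`);
* `finPeriods_eq_univ_of_percolationContinuityZ3` — the summit makes every period good.

So the open FIN RUNG is exactly the statement that the divisibility-upper-set `finPeriods ∋ 0` is all of `ℕ`,
and the line rate already makes it cofinite.
-/

noncomputable section

namespace Summit.CriticalPhenomena.PercolationContinuityZ3.Theorems

open MeasureTheory Filter Topology Literature.Probability.Percolation Literature.Probability.LatticeModels
open scoped ENNReal

/-- The period-`M` fin region `S_M = {0 ≤ x₀} ∪ {x₁ = 0, x₀ ≤ -2} ∪ {x₁ = 0, x₀ = -1, M ∣ x₂}`. -/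
def periodicFinRegion (M : ℕ) : Set (Site 3) :=
  {x : Site 3 | 0 ≤ x 0} ∪
    {x : Site 3 | (x 1 = 0 ∧ x 0 ≤ -2) ∨ (x 1 = 0 ∧ x 0 = -1 ∧ (M : ℤ) ∣ x 2)}

/-- The set of GOOD PERIODS: those `M` for which the period-`M` fin does not percolate at `p_c(ℤ³)`
from the origin. -/
def finPeriods : Set ℕ :=
  {M | ∀ h0 : (0 : Site 3) ∈ periodicFinRegion M,
    theta ((zdGraph 3).induce (periodicFinRegion M)) ⟨0, h0⟩ (criticalProbI 3) = 0}

/-- The origin lies in every `S_M` (it is in the half-space). -/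
theorem zero_mem_periodicFinRegion (M : ℕ) : (0 : Site 3) ∈ periodicFinRegion M :=
  Or.inl (show (0 : ℤ) ≤ (0 : Site 3) 0 from le_rfl)

/-- Membership in `finPeriods`, with the canonical proof of `0 ∈ S_M`. -/
theorem mem_finPeriods_iff (M : ℕ) :
    M ∈ finPeriods ↔ theta ((zdGraph 3).induce (periodicFinRegion M))
      ⟨0, zero_mem_periodicFinRegion M⟩ (criticalProbI 3) = 0 :=
  ⟨fun h => h _, fun h _ => h⟩

/-- Transport of `θ_{G[S]}` along an equality of regions. -/
theorem theta_induce_congr {S T : Set (Site 3)} (h : S = T) (x : Site 3) (hx : x ∈ S)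
    (p : unitInterval) :
    theta ((zdGraph 3).induce S) ⟨x, hx⟩ p = theta ((zdGraph 3).induce T) ⟨x, h ▸ hx⟩ p := by
  subst h; rfl

/-- `S_1` is the fully attached fin `{0 ≤ x₀ ∨ x₁ = 0}`. -/
theorem periodicFinRegion_one : periodicFinRegion 1 = {x : Site 3 | 0 ≤ x 0 ∨ x 1 = 0} := by
  ext x
  simp only [periodicFinRegion, Set.mem_union, Set.mem_setOf_eq, Nat.cast_one, one_dvd, and_true]
  constructor
  · rintro (h | ⟨h1, -⟩ | ⟨h1, -⟩)
    · exact Or.inl h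
    · exact Or.inr h1
    · exact Or.inr h1
  · rintro (h | h1)
    · exact Or.inl h
    · rcases le_or_gt 0 (x 0) with hge | hlt
      · exact Or.inl hge
      · right
        rcases (show x 0 ≤ -2 ∨ x 0 = -1 by omega) with h2 | h2
        · exact Or.inl ⟨h1, h2⟩
        · exact Or.inr ⟨h1, h2⟩

/-- The regions decrease along divisibility: `M ∣ M' → S_{M'} ⊆ S_M`. -/
theorem periodicFinRegion_anti {M M' : ℕ} (h : M ∣ M') :
    periodicFinRegion M' ⊆ periodicFinRegion M := by
  rintro x (hx | ⟨h1, h2⟩ | ⟨h1, h2, h3⟩)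
  · exact Or.inl hx
  · exact Or.inr (Or.inl ⟨h1, h2⟩)
  · exact Or.inr (Or.inr ⟨h1, h2, (Int.natCast_dvd_natCast.2 h).trans h3⟩)

/-- `finPeriods` is an upper set for divisibility (`theta_induce_mono_holds`). -/
theorem finPeriods_dvd_closed {M M' : ℕ} (h : M ∣ M') (hM : M ∈ finPeriods) : M' ∈ finPeriods := by
  intro h0
  refine le_antisymm ?_ ?_
  · calc theta ((zdGraph 3).induce (periodicFinRegion M')) ⟨0, h0⟩ (criticalProbI 3)
          ≤ theta ((zdGraph 3).induce (periodicFinRegion M))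
              ⟨0, periodicFinRegion_anti h h0⟩ (criticalProbI 3) :=
            theta_induce_mono_holds (zdGraph 3) (periodicFinRegion_anti h) 0 h0 _
      _ = 0 := hM _
  · unfold theta; exact measureReal_nonneg

/-- `1 ∈ finPeriods ↔ FinRung`: period one is the fully attached fin. -/
theorem one_mem_finPeriods_iff : 1 ∈ finPeriods ↔ SoloBlindOpenRungs.FinRung := by
  constructor
  · intro h h0
    have h1 := h (zero_mem_periodicFinRegion 1)
    rwa [theta_induce_congr periodicFinRegion_one] at h1
  · intro h h0
    rw [theta_induce_congr periodicFinRegion_one]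
    exact h _

/-- `finPeriods = univ ↔ FinRung`. -/
theorem finPeriods_eq_univ_iff : finPeriods = Set.univ ↔ SoloBlindOpenRungs.FinRung := by
  rw [← one_mem_finPeriods_iff]
  constructor
  · intro h
    rw [h]
    exact Set.mem_univ 1
  · intro h
    exact Set.eq_univ_of_forall fun M => finPeriods_dvd_closed (one_dvd M) h

/-- `0 ∈ finPeriods` UNCONDITIONALLY: period `0` is a single foot at height `0`, a sparse fin with an
empty pair sum (`theta_induce_sparseFin_criticalProbI_eq_zero`). -/
theorem zero_mem_finPeriods : 0 ∈ finPeriods := by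
  intro h0
  haveI : IsEmpty {q : ℤ × ℤ // q.1 ∈ ZM 0 ∧ q.2 ∈ ZM 0 ∧ q.1 ≠ q.2} := by
    refine ⟨fun q => q.2.2.2 ?_⟩
    have h1 : q.1.1 = 0 := zero_dvd_iff.1 (by simpa [ZM] using q.2.1)
    have h2 : q.1.2 = 0 := zero_dvd_iff.1 (by simpa [ZM] using q.2.2.1)
    rw [h1, h2]
  have hsum : ∑' q : {q : ℤ × ℤ // q.1 ∈ ZM 0 ∧ q.2 ∈ ZM 0 ∧ q.1 ≠ q.2},
      (bondPercolation (zdGraph 3) (criticalProbI 3))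
        (openConnVia (withinGraph (zdGraph 3) {x : Site 3 | 0 ≤ x 0})
          (Function.update (0 : Site 3) 2 q.1.1) (Function.update (0 : Site 3) 2 q.1.2)) ≠ ⊤ := by
    rw [tsum_empty]
    exact ENNReal.zero_ne_top
  exact theta_induce_sparseFin_criticalProbI_eq_zero (ZM 0) hsum 0 h0

/-- Under `LineRate` every large period is good (`periodicFin_of_lineRate`). -/
theorem eventually_mem_finPeriods_of_lineRate (hL : SoloBlindOpenRungs.LineRate) :
    ∀ᶠ M in atTop, M ∈ finPeriods := by
  obtain ⟨M₀, hM₀⟩ := periodicFin_of_lineRate hL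
  exact eventually_atTop.2 ⟨M₀, fun M hM h0 => hM₀ M hM h0⟩

/-- Under `LineRate` the set of bad periods is finite. -/
theorem finite_compl_finPeriods_of_lineRate (hL : SoloBlindOpenRungs.LineRate) :
    (finPeriodsᶜ).Finite := by
  obtain ⟨M₀, hM₀⟩ := eventually_atTop.1 (eventually_mem_finPeriods_of_lineRate hL)
  refine (Set.finite_lt_nat M₀).subset fun M hM => ?_
  by_contra hlt
  exact hM (hM₀ M (not_lt.1 hlt))

/-- Under `LineRate`, some POSITIVE period is good (a positive-density attachment rung holds). -/
theorem exists_pos_mem_finPeriods_of_lineRate (hL : SoloBlindOpenRungs.LineRate) :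
    ∃ M : ℕ, 0 < M ∧ M ∈ finPeriods := by
  obtain ⟨M₀, hM₀⟩ := eventually_atTop.1 (eventually_mem_finPeriods_of_lineRate hL)
  exact ⟨M₀ + 1, Nat.succ_pos _, hM₀ _ (Nat.le_succ _)⟩

/-- The summit makes every period good (`periodicFin_of_percolationContinuityZ3`). -/
theorem finPeriods_eq_univ_of_percolationContinuityZ3
    (h : Literature.Probability.Percolation.PercolationContinuityZ3) : finPeriods = Set.univ :=
  Set.eq_univ_of_forall fun M h0 => periodicFin_of_percolationContinuityZ3 h M h0

/-- Hence the summit implies the fin rung through the family (cf. `finRung_of_percolationContinuityZ3`). -/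
theorem finRung_of_percolationContinuityZ3'
    (h : Literature.Probability.Percolation.PercolationContinuityZ3) : SoloBlindOpenRungs.FinRung :=
  finPeriods_eq_univ_iff.1 (finPeriods_eq_univ_of_percolationContinuityZ3 h)

end Summit.CriticalPhenomena.PercolationContinuityZ3.Theorems

end
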